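import Mathlib.Algebra.BigOperators.Group.Finset.Basic
import Literature.AlgebraicGeometry.Frobenioids.DirectSumFactorization
import Literature.AlgebraicGeometry.Frobenioids.FactorizationTransport
import HarnessLib

/-!
# Frobenioids I, Def. 2.4 (i): a direct sum `⊕_i M_i` of monoprime monoids is PERF-FACTORIAL

Mochizuki, *The geometry of Frobenioids I*, Kyushu J. Math. **62** (2008), §2, Definition 2.4 (i) p. 47, and the
motivating examples Ex. 6.1 p. 109 ("one verifies immediately that `Φ(L)` is perf-factorial"), Ex. 6.3 p. 113
("Thus [cf. §0], `Φ(L)` (`≠ 0`) is perf-factorial") [cite: MochizukiFrdI2008, Def. 2.4(i) p.47]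
[cite: MochizukiFrdI2008, Ex. 6.3 p.113].

**Theorem (`DirectSum.isPerfFactorial`).** If every `M_i` is monoprime then `⊕_i M_i` is perf-factorial.
Assembly (`IsPerfFactorial.of_cond`): (a) `⊕_i M_i` is divisorial (`DirectSumMonoids.lean`); (b) every
`(⊕ M)_𝔭 ≅ M_i` is monoprime (`DirectSumPrimes.lean`); (c)(d) hold for `⊕_i M_i^pf` relative to its primes
(`DirectSumFactorization.lean`, the `M_i^pf` being monoprime) and are transported along the isomorphism
**`(⊕_i M_i)^pf ≅ ⊕_i M_i^pf`** (`perfectionEquiv`: the perfection commutes with direct sums — on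
representatives `(f, n) ↦ (f_i^{1/n})_i`; injective since `n`-th powers are injective in a monoprime monoid,
surjective by passing to a common denominator over the finite support).
Seat abc-iut-L1-d2 (cell abc-iut); sub-DAG row FrdI:Thm6.4(i)/T64i-L02.
-/

noncomputable section

namespace Literature.AlgebraicGeometry.Frobenioids

open Function Literature.AnabelianGeometry.EtaleTheta

universe u v

/-! ### `n`-th powers are injective in a monoprime monoid -/

namespace IsMonoprime

variable {N : Type u} [CommMonoid N]

/-- In a monoprime monoid the power maps `a ↦ a^n`, `n ≥ 1`, are injective (`≅ Λ_{≥0} ⊆ ℝ_{≥0}`).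
[cite: MochizukiFrdI2008, §0 p.10] -/
theorem pow_left_injective' (hN : IsMonoprime N) {n : ℕ} (hn : 0 < n) : Injective fun a : N => a ^ n := by
  obtain ⟨f⟩ := RealificationCoord.nonempty_coord hN
  have hg : Injective (f.toMonoidHom.comp (Realification.of N)) :=
    f.injective.comp (Realification.of_injective hN)
  intro a b hab
  apply hg
  have h := congrArg (f.toMonoidHom.comp (Realification.of N)) hab
  dsimp only at h
  rw [map_pow, map_pow] at h
  apply Multiplicative.toAdd.injective
  have h' := congrArg Multiplicative.toAdd h
  rw [toAdd_pow, toAdd_pow, nsmul_eq_mul, nsmul_eq_mul] at h'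
  exact mul_left_cancel₀ (Nat.cast_ne_zero.mpr hn.ne') h'

end IsMonoprime

/-! ### `(⊕_i M_i)^pf ≅ ⊕_i M_i^pf` -/

namespace DirectSum

variable {ι : Type u} {M : ι → Type v} [∀ i, CommMonoid (M i)] [DecidableEq ι]

/-- On representatives: `(f, n) ↦ (f_i^{1/n})_i`. [cite: MochizukiFrdI2008, §0 p.11] -/
def splitFun (x : directSum M × ℕ+) : directSum (fun i => Perfection (M i)) :=
  ⟨fun i => Perfection.mk ((x.1 : ∀ j, M j) i) x.2, (finite_dsupp x.1).subset fun i hi => by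
    by_contra h
    rw [mem_dsupp_iff, not_not] at h
    apply hi
    show Perfection.mk ((x.1 : ∀ j, M j) i) x.2 = 1
    rw [h, Perfection.mk_one]⟩

omit [DecidableEq ι] in
/-- `splitFun` respects the defining relation of the perfection. [cite: MochizukiFrdI2008, §0 p.11] -/
theorem splitFun_congr {x y : directSum M × ℕ+} (h : PerfectionRel (directSum M) x y) :
    splitFun x = splitFun y := by
  obtain ⟨N, hN⟩ := h
  apply Subtype.ext
  funext i
  show Perfection.mk _ _ = Perfection.mk _ _
  rw [Perfection.mk_eq_mk_iff]
  refine ⟨N, ?_⟩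
  have := congrArg (fun z : directSum M => (z : ∀ j, M j) i) hN
  simpa only [coe_pow, Pi.pow_apply] using this

/-- **`(⊕_i M_i)^pf → ⊕_i M_i^pf`**, `f^{1/n} ↦ (f_i^{1/n})_i`, a homomorphism.
[cite: MochizukiFrdI2008, §0 p.11] -/
def perfectionSplit : Perfection (directSum M) →* directSum (fun i => Perfection (M i)) where
  toFun := Quotient.lift splitFun fun _ _ h => splitFun_congr h
  map_one' := by
    apply Subtype.ext
    funext i
    show Perfection.mk (((1 : directSum M) : ∀ j, M j) i) 1 = 1
    rw [coe_one, Pi.one_apply, Perfection.mk_one]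
  map_mul' x y := by
    obtain ⟨⟨f, n⟩, rfl⟩ := Perfection.mk_surjective x
    obtain ⟨⟨g, m⟩, rfl⟩ := Perfection.mk_surjective y
    apply Subtype.ext
    funext i
    show Perfection.mk (((f ^ (m : ℕ) * g ^ (n : ℕ) : directSum M) : ∀ j, M j) i) (n * m) =
      Perfection.mk ((f : ∀ j, M j) i) n * Perfection.mk ((g : ∀ j, M j) i) m
    rw [Perfection.mk_mul_mk]
    rfl

omit [DecidableEq ι] in
/-- `perfectionSplit` on classes, componentwise. [cite: MochizukiFrdI2008, §0 p.11] -/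
@[simp] theorem perfectionSplit_mk (f : directSum M) (n : ℕ+) (i : ι) :
    ((perfectionSplit (Perfection.mk f n) : directSum fun j => Perfection (M j)) : ∀ j, Perfection (M j)) i =
      Perfection.mk ((f : ∀ j, M j) i) n := rfl

omit [DecidableEq ι] in
/-- `perfectionSplit` is injective for monoprime `M_i` (`n`-th powers are injective in each `M_i`).
[cite: MochizukiFrdI2008, §0 p.11] -/
theorem perfectionSplit_injective (hM : ∀ i, IsMonoprime (M i)) : Injective (perfectionSplit (M := M)) := by
  intro x y hxy
  obtain ⟨⟨f, n⟩, rfl⟩ := Perfection.mk_surjective x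
  obtain ⟨⟨g, m⟩, rfl⟩ := Perfection.mk_surjective y
  dsimp only at hxy ⊢
  rw [Perfection.mk_eq_mk_iff]
  refine ⟨1, ?_⟩
  rw [PNat.one_coe, one_mul, one_mul]
  apply Subtype.ext
  funext i
  rw [coe_pow, coe_pow, Pi.pow_apply, Pi.pow_apply]
  have hi := congrArg (fun z : directSum (fun j => Perfection (M j)) => (z : ∀ j, Perfection (M j)) i) hxy
  simp only [perfectionSplit_mk] at hi
  obtain ⟨N, hN⟩ := Perfection.mk_eq_mk_iff.mp hi
  rw [pow_mul', pow_mul'] at hN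
  exact IsMonoprime.pow_left_injective' (hM i) N.pos hN

/-- `perfectionSplit` is surjective: pass to a common denominator over the finite support.
[cite: MochizukiFrdI2008, §0 p.11] -/
theorem perfectionSplit_surjective : Surjective (perfectionSplit (M := M)) := by
  intro g
  have hrep : ∀ i, ∃ p : M i × ℕ+, Perfection.mk p.1 p.2 = (g : ∀ j, Perfection (M j)) i :=
    fun i => Perfection.mk_surjective _
  choose p hp using hrep
  obtain ⟨S, hS⟩ : ∃ S : Finset ι, ∀ i, i ∈ S ↔ i ∈ dsupp (g : ∀ j, Perfection (M j)) :=
    ⟨(finite_dsupp g).toFinset, fun i => (finite_dsupp g).mem_toFinset⟩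
  obtain ⟨n, hn⟩ : ∃ n : ℕ+, ∀ i ∈ S, ∃ k : ℕ+, n = (p i).2 * k :=
    ⟨∏ i ∈ S, (p i).2, fun i hi => Finset.dvd_prod_of_mem (fun i => (p i).2) hi⟩
  let f : ∀ i, M i := fun i => if i ∈ S then (p i).1 ^ ((n : ℕ) / ((p i).2 : ℕ)) else 1
  have hf : f ∈ directSum M := by
    refine S.finite_toSet.subset fun i hi => ?_
    rw [Finset.mem_coe]
    by_contra h
    exact hi (if_neg h)
  refine ⟨Perfection.mk ⟨f, hf⟩ n, Subtype.ext (funext fun i => ?_)⟩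
  rw [perfectionSplit_mk]
  show Perfection.mk (f i) n = _
  by_cases hi : i ∈ S
  · obtain ⟨k, hk⟩ := hn i hi
    have hdiv : (n : ℕ) / ((p i).2 : ℕ) = k := by
      rw [hk, PNat.mul_coe, Nat.mul_div_cancel_left _ (p i).2.pos]
    have hfi : f i = (p i).1 ^ (k : ℕ) := by
      show (if i ∈ S then (p i).1 ^ ((n : ℕ) / ((p i).2 : ℕ)) else 1) = _
      rw [if_pos hi, hdiv]
    rw [hfi, hk, Perfection.mk_pow_mul, hp]
  · have hfi : f i = 1 := if_neg hi
    rw [hfi, Perfection.mk_one]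
    by_contra hne
    exact hi ((hS i).mpr (Ne.symm hne))

/-- **`(⊕_i M_i)^pf ≅ ⊕_i M_i^pf`** for monoprime `M_i`: the perfection commutes with direct sums.
[cite: MochizukiFrdI2008, §0 p.11] -/
def perfectionEquiv (hM : ∀ i, IsMonoprime (M i)) :
    Perfection (directSum M) ≃* directSum (fun i => Perfection (M i)) :=
  MulEquiv.ofBijective perfectionSplit ⟨perfectionSplit_injective hM, perfectionSplit_surjective⟩

/-! ### The theorem -/

/-- **A direct sum `⊕_i M_i` of monoprime monoids is perf-factorial** (Def. 2.4 (i)): (a) divisorial, (b) each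
`(⊕ M)_𝔭 ≅ M_i` monoprime, (c)(d) for `(⊕ M)^pf ≅ ⊕ M_i^pf` relative to its primes (the `M_i^pf` being
monoprime).  This is the computation behind "`Φ(L)` is perf-factorial" in Ex. 6.1 / Ex. 6.3.
[cite: MochizukiFrdI2008, Def. 2.4(i) p.47] -/
theorem isPerfFactorial (hM : ∀ i, IsMonoprime (M i)) : IsPerfFactorial (directSum M) :=
  IsPerfFactorial.of_cond (isDivisorial hM) (isMonoprime_submonoid hM)
    (Factorization.Cond.of_mulEquiv (perfectionEquiv hM).symm
      (cond fun i => PerfectionPrimes.isMonoprime_perfection (hM i)))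

end DirectSum

end Literature.AlgebraicGeometry.Frobenioids
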